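import Summits.ValiantsHypothesis.ValiantsHypothesis.Theses.SuccinctLift
import Mathlib.GroupTheory.Perm.List
import Mathlib.LinearAlgebra.Matrix.Permanent

/-!
# Line `char2`, stub T3 = `MajorityPermanentMod2` (stmt 26305) — PROOF

`MAJ_k` is a projection of the permanent mod 2: an explicit `m × m` matrix of literals/constants,
`m = (k+1)² + 1 ≤ (k+2)²`, whose permanent over `ZMod 2` is `[MAJ_k(x)]`.  Construction: the
cycle-cover count of the layered "ones-counter" graph (states `(j, c)` = after reading `j` bits,
`c` ones; sink `t`; edge `t → s`; self-loops on all states but `s`) is `1` if `MAJ(x)` else `0`.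
-/

namespace Summit.ValiantsHypothesis.ValiantsHypothesis.Theorems.SuccinctLiftCharTwo
open Literature.Computability.Complexity Literature.Computability.MetaComplexity.Smolensky
  Summit.ValiantsHypothesis.ValiantsHypothesis.Theses.SuccinctLift

variable {k : ℕ}
/-- Literal evaluation, syntactically the route's form. -/
def lit (x : Fin k → Bool) (l : Bool ⊕ (Fin k × Bool)) : Bool :=
  Sum.elim (fun b : Bool => b) (fun ip : Fin k × Bool => if ip.2 then x ip.1 else !x ip.1) l

/-- Input bits extended to `ℕ` (false beyond `k`). -/
def xb (x : Fin k → Bool) (j : ℕ) : Bool := if h : j < k then x ⟨j, h⟩ else false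

/-- Number of ones among the first `j` bits. -/
def cnt (x : Fin k → Bool) : ℕ → ℕ
  | 0 => 0
  | j + 1 => cnt x j + (if xb x j then 1 else 0)

/-- Helper `cnt_succ` of the char-2 line (see the module docstring). -/
theorem cnt_succ (x : Fin k → Bool) (j : ℕ) :
    cnt x (j + 1) = cnt x j + (if xb x j then 1 else 0) := rfl

/-- Helper `cnt_zero` of the char-2 line (see the module docstring). -/
theorem cnt_zero (x : Fin k → Bool) : cnt x 0 = 0 := rfl

/-- Helper `cnt_le` of the char-2 line (see the module docstring). -/
theorem cnt_le (x : Fin k → Bool) : ∀ j, cnt x j ≤ j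
  | 0 => by simp [cnt]
  | j + 1 => by have := cnt_le x j; simp only [cnt]; split_ifs <;> omega

/-- Helper `cnt_eq_sum` of the char-2 line (see the module docstring). -/
theorem cnt_eq_sum (x : Fin k → Bool) (j : ℕ) :
    cnt x j = ∑ i ∈ Finset.range j, (if xb x i then 1 else 0) := by
  induction j with
  | zero => simp [cnt]
  | succ j ih => simp only [cnt, Finset.sum_range_succ, ih]

/-- Helper `cnt_k` of the char-2 line (see the module docstring). -/
theorem cnt_k (x : Fin k → Bool) : cnt x k = GateFn.numOnes x := by
  rw [cnt_eq_sum, GateFn.numOnes, Finset.card_filter,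
    ← Fin.sum_univ_eq_sum_range (fun i => if xb x i then 1 else 0) k]
  refine Finset.sum_congr rfl fun i _ => ?_
  simp [xb, i.2]

/-- Vertices: `none` = the sink `t`; `some (j, c)`. -/
abbrev V (k : ℕ) := Option (Fin (k + 1) × Fin (k + 1))

/-- Edge labels `v → w`. -/
def lab (k : ℕ) : V k → V k → Bool ⊕ (Fin k × Bool)
  | none, some w => Sum.inl (decide (w = (0, 0)))
  | none, none => Sum.inl false
  | some v, none => Sum.inl (decide ((v.1 : ℕ) = k ∧ k ≤ 2 * (v.2 : ℕ)))
  | some v, some w =>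
      if h : (v.1 : ℕ) < k ∧ (w.1 : ℕ) = v.1 + 1 ∧ (w.2 : ℕ) = v.2 + 1 then Sum.inr (⟨v.1, h.1⟩, true)
      else if h : (v.1 : ℕ) < k ∧ (w.1 : ℕ) = v.1 + 1 ∧ (w.2 : ℕ) = v.2 then
        Sum.inr (⟨v.1, h.1⟩, false)
      else Sum.inl (decide (w = v ∧ v ≠ (0, 0)))

section Labels
variable (x : Fin k → Bool)
/-- Helper `lit_none_some` of the char-2 line (see the module docstring). -/
@[simp] theorem lit_none_some (w : Fin (k + 1) × Fin (k + 1)) :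
    lit x (lab k none (some w)) = decide (w = (0, 0)) := rfl

/-- Helper `lit_none_none` of the char-2 line (see the module docstring). -/
@[simp] theorem lit_none_none : lit x (lab k none none) = false := rfl

/-- Helper `lit_some_none` of the char-2 line (see the module docstring). -/
@[simp] theorem lit_some_none (v : Fin (k + 1) × Fin (k + 1)) :
    lit x (lab k (some v) none) = decide ((v.1 : ℕ) = k ∧ k ≤ 2 * (v.2 : ℕ)) := rfl

/-- Helper `lit_some_some` of the char-2 line (see the module docstring). -/
theorem lit_some_some (v w : Fin (k + 1) × Fin (k + 1)) :
    lit x (lab k (some v) (some w)) =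
      if (v.1 : ℕ) < k ∧ (w.1 : ℕ) = v.1 + 1 ∧ (w.2 : ℕ) = v.2 + 1 then xb x v.1
      else if (v.1 : ℕ) < k ∧ (w.1 : ℕ) = v.1 + 1 ∧ (w.2 : ℕ) = v.2 then !xb x v.1
      else decide (w = v ∧ v ≠ (0, 0)) := by
  simp only [lab]
  by_cases h1 : (v.1 : ℕ) < k ∧ (w.1 : ℕ) = v.1 + 1 ∧ (w.2 : ℕ) = v.2 + 1
  · simp only [dif_pos h1, if_pos h1]; simp [lit, xb, h1.1]
  · simp only [dif_neg h1, if_neg h1]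
    by_cases h2 : (v.1 : ℕ) < k ∧ (w.1 : ℕ) = v.1 + 1 ∧ (w.2 : ℕ) = v.2
    · simp only [dif_pos h2, if_pos h2]; simp [lit, xb, h2.1]
    · simp only [dif_neg h2, if_neg h2]; simp [lit]
end Labels

/-- The chain vertex at level `j`: `(j, cnt x j)`. -/
def A (x : Fin k → Bool) (j : Fin (k + 1)) : Fin (k + 1) × Fin (k + 1) :=
  (j, ⟨cnt x j, Nat.lt_succ_of_le ((cnt_le x j).trans (Nat.le_of_lt_succ j.2))⟩)

/-- Helper `A_fst` of the char-2 line (see the module docstring). -/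
@[simp] theorem A_fst (x : Fin k → Bool) (j : Fin (k + 1)) : (A x j).1 = j := rfl
/-- Helper `A_snd_val` of the char-2 line (see the module docstring). -/
@[simp] theorem A_snd_val (x : Fin k → Bool) (j : Fin (k + 1)) : ((A x j).2 : ℕ) = cnt x j := rfl

/-- Helper `eq_A_of_snd` of the char-2 line (see the module docstring). -/
theorem eq_A_of_snd (x : Fin k → Bool) (v : Fin (k + 1) × Fin (k + 1))
    (hv : (v.2 : ℕ) = cnt x v.1) : v = A x v.1 :=
  Prod.ext rfl (Fin.ext hv)

/-- Helper `eq_A_iff` of the char-2 line (see the module docstring). -/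
theorem eq_A_iff (x : Fin k → Bool) (v : Fin (k + 1) × Fin (k + 1)) (j : Fin (k + 1)) :
    v = A x j ↔ (v.1 : ℕ) = j ∧ (v.2 : ℕ) = cnt x j := by
  constructor
  · rintro rfl; simp [A]
  · rintro ⟨h1, h2⟩; exact Prod.ext (Fin.ext h1) (Fin.ext (by simpa [A] using h2))

/-- Helper `A_zero` of the char-2 line (see the module docstring). -/
theorem A_zero (x : Fin k → Bool) : A x 0 = (0, 0) :=
  Prod.ext rfl (Fin.ext (by simp [A, cnt]))

section Forcing
/-! ### Any fully active permutation is the canonical one -/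

variable (x : Fin k → Bool) (σ : Equiv.Perm (V k)) (hσ : ∀ v, lit x (lab k v (σ v)) = true)
include hσ

/-- Helper `force_none` of the char-2 line (see the module docstring). -/
theorem force_none : σ none = some (0, 0) := by
  have h := hσ none
  cases hsn : σ none with
  | none => rw [hsn] at h; simp at h
  | some w => rw [hsn] at h; simpa using h

/-- One forcing step along the chain. -/
theorem force_step (p : V k) (v : Fin (k + 1) × Fin (k + 1)) (hp : σ p = some v)
    (hpv : p ≠ some v) (hv : (v.2 : ℕ) = cnt x v.1) :
    ((v.1 : ℕ) < k → ∃ w : Fin (k + 1) × Fin (k + 1), σ (some v) = some w ∧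
        (w.1 : ℕ) = v.1 + 1 ∧ (w.2 : ℕ) = cnt x (v.1 + 1)) ∧
    ((v.1 : ℕ) = k → σ (some v) = none ∧ k ≤ 2 * cnt x k) := by
  have hne : σ (some v) ≠ some v := by
    intro h; exact hpv (σ.injective (hp.trans h.symm))
  have h := hσ (some v)
  cases hsv : σ (some v) with
  | none =>
    rw [hsv] at h; simp only [lit_some_none, decide_eq_true_eq] at h
    refine ⟨fun hlt => absurd h.1 (Nat.ne_of_lt hlt), fun hk => ⟨rfl, ?_⟩⟩
    have hc : cnt x k = (v.2 : ℕ) := by rw [hv, hk]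
    rw [hc]; exact h.2
  | some w =>
    rw [hsv] at h hne
    rw [lit_some_some] at h
    have hwv : ¬ (w = v ∧ v ≠ (0, 0)) := fun hh => hne (congrArg some hh.1)
    split_ifs at h with h1 h2
    · refine ⟨fun _ => ⟨w, rfl, h1.2.1, ?_⟩, fun hk => absurd h1.1 (by omega)⟩
      rw [h1.2.2, hv, cnt_succ, if_pos h]
    · refine ⟨fun _ => ⟨w, rfl, h2.2.1, ?_⟩, fun hk => absurd h2.1 (by omega)⟩
      have hx : xb x v.1 = false := by simpa using h
      rw [h2.2.2, hv, cnt_succ, hx]; simp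
    · exact absurd (of_decide_eq_true h) hwv

/-- The chain is forced: `σ (A j) = A (j+1)` for `j < k`, `σ (A k) = t`, and majority holds. -/
theorem force_chain :
    (∀ j : Fin (k + 1), ∀ hj : (j : ℕ) < k,
        σ (some (A x j)) = some (A x ⟨j + 1, Nat.succ_lt_succ hj⟩)) ∧
      σ (some (A x (Fin.last k))) = none ∧ k ≤ 2 * cnt x k := by
  -- invariant: A j is the image of some p ≠ A j
  have inv : ∀ j : ℕ, ∀ hj : j < k + 1, ∃ p : V k, p ≠ some (A x ⟨j, hj⟩) ∧
      σ p = some (A x ⟨j, hj⟩) := by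
    intro j
    induction j with
    | zero =>
      intro hj
      exact ⟨none, by simp, by rw [force_none x σ hσ]; exact congrArg some (A_zero x).symm⟩
    | succ j ih =>
      intro hj
      obtain ⟨p, hp, hσp⟩ := ih (by omega)
      have hst := (force_step x σ hσ p _ hσp hp rfl).1 (by simpa using hj)
      obtain ⟨w, hw, hw1, hw2⟩ := hst
      simp only [A_fst, Fin.val_mk] at hw1 hw2
      refine ⟨some (A x ⟨j, by omega⟩), ?_, ?_⟩
      · simp only [ne_eq, Option.some.injEq]
        intro h
        have := ((eq_A_iff x _ _).1 h).1
        simp at this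
      · rw [hw, (eq_A_iff x w ⟨j + 1, hj⟩).2 ⟨hw1, hw2⟩]
  refine ⟨fun j hj => ?_, ?_⟩
  · obtain ⟨p, hp, hσp⟩ := inv j j.2
    obtain ⟨w, hw, hw1, hw2⟩ := (force_step x σ hσ p _ hσp hp rfl).1 hj
    simp only [A_fst] at hw1 hw2
    rw [hw, (eq_A_iff x w ⟨j + 1, Nat.succ_lt_succ hj⟩).2 ⟨hw1, hw2⟩]
  · obtain ⟨p, hp, hσp⟩ := inv k (Nat.lt_succ_self k)
    exact (force_step x σ hσ p _ hσp hp rfl).2 rfl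

/-- Off-chain states are fixed. -/
theorem force_offchain : ∀ d : ℕ, ∀ v : Fin (k + 1) × Fin (k + 1), (v.1 : ℕ) + d = k →
    (v.2 : ℕ) ≠ cnt x v.1 → σ (some v) = some v := by
  obtain ⟨hch, hlast, _⟩ := force_chain x σ hσ
  intro d
  induction d with
  | zero =>
    intro v hd hv
    have h := hσ (some v)
    cases hsv : σ (some v) with
    | none =>
      exfalso
      have : some v = some (A x (Fin.last k)) := σ.injective (hsv.trans hlast.symm)
      simp only [Option.some.injEq] at this
      exact hv (by rw [this]; simp [A])
    | some w =>
      rw [hsv, lit_some_some] at h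
      split_ifs at h with h1 h2
      · omega
      · omega
      · exact congrArg some (of_decide_eq_true h).1
  | succ d ih =>
    intro v hd hv
    have h := hσ (some v)
    cases hsv : σ (some v) with
    | none =>
      exfalso
      have : some v = some (A x (Fin.last k)) := σ.injective (hsv.trans hlast.symm)
      simp only [Option.some.injEq] at this
      exact hv (by rw [this]; simp [A])
    | some w =>
      rw [hsv, lit_some_some] at h
      -- forward edge to w (on or off chain) or loop
      have fwd : (v.1 : ℕ) < k → (w.1 : ℕ) = v.1 + 1 → False := by
        intro hlt hw1
        by_cases hw : (w.2 : ℕ) = cnt x w.1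
        · -- w on chain: w = A (v.1+1) = σ (A v.1) ⇒ v = A v.1
          have hwA : w = A x ⟨(v.1 : ℕ) + 1, Nat.succ_lt_succ hlt⟩ :=
            (eq_A_iff x w _).2 ⟨hw1, by rw [hw, hw1]⟩
          have hAv := hch v.1 hlt
          have : some v = some (A x v.1) := σ.injective (by rw [hsv, hAv, hwA])
          simp only [Option.some.injEq] at this
          exact hv (by rw [this]; simp [A])
        · have hfix := ih w (by omega) hw
          have : some v = some w := σ.injective (hsv.trans hfix.symm)
          simp only [Option.some.injEq] at this
          rw [← this] at hw1; omega
      split_ifs at h with h1 h2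
      · exact (fwd h1.1 h1.2.1).elim
      · exact (fwd h2.1 h2.2.1).elim
      · exact congrArg some (of_decide_eq_true h).1

/-- Uniqueness: two fully active permutations coincide. -/
theorem force_unique (τ : Equiv.Perm (V k)) (hτ : ∀ v, lit x (lab k v (τ v)) = true) : σ = τ := by
  obtain ⟨hchσ, hlastσ, _⟩ := force_chain x σ hσ
  obtain ⟨hchτ, hlastτ, _⟩ := force_chain x τ hτ
  ext1 v
  cases v with
  | none => rw [force_none x σ hσ, force_none x τ hτ]
  | some w =>
    by_cases hw : (w.2 : ℕ) = cnt x w.1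
    · have hwA := eq_A_of_snd x w hw
      by_cases hlt : (w.1 : ℕ) < k
      · rw [hwA, hchσ _ hlt, hchτ _ hlt]
      · have hk : w.1 = Fin.last k := Fin.ext (by simp; omega)
        rw [hwA, hk, hlastσ, hlastτ]
    · rw [force_offchain x σ hσ (k - w.1) w (by omega) hw,
        force_offchain x τ hτ (k - w.1) w (by omega) hw]

/-- Helper `maj_of_active` of the char-2 line (see the module docstring). -/
theorem maj_of_active : k ≤ 2 * GateFn.numOnes x := by
  rw [← cnt_k]; exact (force_chain x σ hσ).2.2
end Forcing

/-! ### The canonical permutation (existence, when majority holds) -/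

/-- The list `[t, A 0, A 1, …, A k]`. -/
def chainList (x : Fin k → Bool) : List (V k) :=
  none :: (List.finRange (k + 1)).map fun j => some (A x j)

/-- Helper `chainList_length` of the char-2 line (see the module docstring). -/
theorem chainList_length (x : Fin k → Bool) : (chainList x).length = k + 2 := by
  simp [chainList]

/-- Helper `chainList_nodup` of the char-2 line (see the module docstring). -/
theorem chainList_nodup (x : Fin k → Bool) : (chainList x).Nodup := by
  refine List.nodup_cons.2 ⟨by simp, (List.nodup_finRange (k + 1)).map ?_⟩
  intro j₁ j₂ h
  simpa [A] using congrArg (fun q : V k => q.map Prod.fst) h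

/-- Helper `chainList_getElem_zero` of the char-2 line (see the module docstring). -/
theorem chainList_getElem_zero (x : Fin k → Bool) (h : 0 < (chainList x).length) :
    (chainList x)[0] = none := rfl

/-- Helper `chainList_getElem_succ` of the char-2 line (see the module docstring). -/
theorem chainList_getElem_succ (x : Fin k → Bool) (j : ℕ) (hj : j < k + 1)
    (h : j + 1 < (chainList x).length) : (chainList x)[j + 1] = some (A x ⟨j, hj⟩) := by
  simp [chainList, List.getElem_cons_succ, List.getElem_map, List.getElem_finRange]

/-- Helper `mem_chainList_some` of the char-2 line (see the module docstring). -/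
theorem mem_chainList_some (x : Fin k → Bool) (w : Fin (k + 1) × Fin (k + 1)) :
    some w ∈ chainList x ↔ (w.2 : ℕ) = cnt x w.1 := by
  simp only [chainList, List.mem_cons, List.mem_map, List.mem_finRange, true_and,
    Option.some.injEq, reduceCtorEq, false_or]
  constructor
  · rintro ⟨j, rfl⟩; simp [A]
  · intro h; exact ⟨w.1, (eq_A_of_snd x w h).symm⟩

/-- The canonical cycle cover's permutation. -/
def canon (x : Fin k → Bool) : Equiv.Perm (V k) := (chainList x).formPerm

/-- Helper `canon_none` of the char-2 line (see the module docstring). -/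
theorem canon_none (x : Fin k → Bool) : canon x none = some (A x 0) := by
  have h := List.formPerm_apply_lt_getElem (chainList x) (chainList_nodup x) 0
    (by rw [chainList_length]; omega)
  rw [chainList_getElem_succ x 0 (by omega)] at h
  exact h

/-- Helper `canon_A_lt` of the char-2 line (see the module docstring). -/
theorem canon_A_lt (x : Fin k → Bool) (j : Fin (k + 1)) (hj : (j : ℕ) < k) :
    canon x (some (A x j)) = some (A x ⟨j + 1, Nat.succ_lt_succ hj⟩) := by
  have h := List.formPerm_apply_lt_getElem (chainList x) (chainList_nodup x) (j + 1)
    (by rw [chainList_length]; omega)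
  rw [chainList_getElem_succ x j j.2, chainList_getElem_succ x (j + 1) (by omega)] at h
  exact h

/-- Helper `canon_A_last` of the char-2 line (see the module docstring). -/
theorem canon_A_last (x : Fin k → Bool) : canon x (some (A x (Fin.last k))) = none := by
  have h := List.formPerm_apply_getElem (chainList x) (chainList_nodup x) (k + 1)
    (by rw [chainList_length]; omega)
  rw [chainList_getElem_succ x k (by omega)] at h
  have h0 : ∀ (i : ℕ) (hi : i < (chainList x).length), i = 0 → (chainList x)[i] = none := by
    rintro i hi rfl; rfl
  rw [h0 _ _ (by simp [chainList_length])] at h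
  exact h

/-- Helper `canon_offchain` of the char-2 line (see the module docstring). -/
theorem canon_offchain (x : Fin k → Bool) (w : Fin (k + 1) × Fin (k + 1))
    (hw : (w.2 : ℕ) ≠ cnt x w.1) : canon x (some w) = some w :=
  List.formPerm_apply_of_notMem (by rw [mem_chainList_some]; exact hw)

/-- Helper `canon_active` of the char-2 line (see the module docstring). -/
theorem canon_active (x : Fin k → Bool) (hmaj : k ≤ 2 * GateFn.numOnes x) (v : V k) :
    lit x (lab k v (canon x v)) = true := by
  cases v with
  | none => rw [canon_none, A_zero]; simp
  | some w =>
    by_cases hw : (w.2 : ℕ) = cnt x w.1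
    · have hwA := eq_A_of_snd x w hw
      by_cases hlt : (w.1 : ℕ) < k
      · rw [hwA, canon_A_lt x _ hlt, lit_some_some]
        simp only [A_fst, A_snd_val, cnt]
        cases hx : xb x (w.1 : ℕ) <;> simp [hlt]
      · have hk : w.1 = Fin.last k := Fin.ext (by simp; omega)
        rw [hwA, hk, canon_A_last, lit_some_none]
        simp [A, cnt_k, hmaj]
    · rw [canon_offchain x w hw, lit_some_some]
      have h0 : w ≠ (0, 0) := by
        rintro rfl; exact hw (by simp [cnt])
      simp [h0]

/-! ### Counting cycle covers -/

/-- Helper `sum_perm_eq` of the char-2 line (see the module docstring). -/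
theorem sum_perm_eq (x : Fin k → Bool) :
    (∑ τ : Equiv.Perm (V k), ∏ v, (if lit x (lab k v (τ v)) then (1 : ZMod 2) else 0)) =
      if majorityFn k x then 1 else 0 := by
  classical
  simp_rw [Fintype.prod_boole, Finset.sum_boole]
  by_cases hmaj : k ≤ 2 * GateFn.numOnes x
  · have hset : (Finset.univ.filter fun τ : Equiv.Perm (V k) =>
        ∀ v, lit x (lab k v (τ v)) = true) = {canon x} := by
      refine Finset.eq_singleton_iff_unique_mem.2 ⟨?_, fun τ hτ => ?_⟩
      · simpa using canon_active x hmaj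
      · exact force_unique x τ (by simpa using hτ) (canon x) (canon_active x hmaj)
    rw [hset]; simp [majorityFn, hmaj]
  · have hset : (Finset.univ.filter fun τ : Equiv.Perm (V k) =>
        ∀ v, lit x (lab k v (τ v)) = true) = ∅ := by
      refine Finset.filter_eq_empty_iff.2 fun τ _ hτ => hmaj (maj_of_active x τ hτ)
    rw [hset]; simp [majorityFn, hmaj]

/-- Transport of a "graph" matrix along an equivalence. -/
theorem permanent_transport {α β R : Type*} [Fintype α] [DecidableEq α] [Fintype β]
    [DecidableEq β] [CommRing R] (e : α ≃ β) (f : β → β → R) :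
    (Matrix.of fun i j : α => f (e j) (e i)).permanent = ∑ τ : Equiv.Perm β, ∏ v, f v (τ v) := by
  unfold Matrix.permanent
  refine Fintype.sum_equiv e.permCongr _ _ fun σ => ?_
  simp only [Matrix.of_apply]
  exact Fintype.prod_equiv e _ _ fun i => by simp

/-- **T3 (stmt 26305), kernel.** -/
theorem majorityPermanentMod2_proof : MajorityPermanentMod2 := by
  intro k
  classical
  have hcard : Fintype.card (Fin ((k + 1) * (k + 1) + 1)) = Fintype.card (V k) := by
    simp [Fintype.card_option, Fintype.card_prod]
  let e : Fin ((k + 1) * (k + 1) + 1) ≃ V k := Fintype.equivOfCardEq hcard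
  refine ⟨(k + 1) * (k + 1) + 1, by nlinarith, fun ij => lab k (e ij.2) (e ij.1), fun x => ?_⟩
  have h := permanent_transport e (fun v w => if lit x (lab k v w) then (1 : ZMod 2) else 0)
  rw [sum_perm_eq] at h
  exact h
end Summit.ValiantsHypothesis.ValiantsHypothesis.Theorems.SuccinctLiftCharTwo
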